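import Summits.CriticalPhenomena.CardyFormulaZ2.Theorems.CardyBoundaryCoulombGasRectilinearCardyStubEventIdentityPart3
import Summits.CriticalPhenomena.CardyFormulaZ2.Theorems.CardyBoundaryCoulombGasRectilinearCardyStubEventIdentityPart10

/-!
# Stub `stub_eventIdentity` of line `excursion-kernel-covariance` (crux `RectilinearCardy`,
# stmt-CriticalPhenomena-5660) — Part 11: the hull event forces the rainbow pairing
# (exclusion W1 of the design `Lines/excursion-kernel-covariance-eventIdentity-design.md`)

Setting of Parts 6–10; `v = (e 1).1` the jump vertex, `W₁`, `W₂` the two wired vertex blocks,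
`≈` = joined by edges of `ω`. THEOREM `ei_rainbow_of_hull`: if `v ≈ W₁` and `¬ W₂ ≈ W₁` then the
strands pair `e_v'' → e_A`, `e_B → e_v'`, `e_X → e_C` (hence `ω` is rainbow, Part 7).

* The strand from `e_X` ends at `e_C`: by the CLASS LEMMA at level `-3` (Part 10) the cluster of
  the ghost `g_X` meets `V` only in vertices `≈`-joined to `W₂` and leaves `V` only at level `-3`;
  the other two terminals sit at `v` (`≈ W₁`) and at `g_A` (level `-1`).
* The strand from the jump start `e_v''` does not end at the jump finish `e_v'`: otherwise its orbit
  loop is that strand closed up by the turn `e_v' ↦ e_v''`, missing `e_A` and hence the corner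
  `r = (A, K_A + 3)` before it (the spoke `{A, g_A}` is open, `σ r = e_A`); but `v ~β A` (the
  `ω`-path to `W₁`, then the wired chain) and the collar faces from `F_vA = cFace e_v''` to
  `F_beforeA = cFace r` form a closed-edge face chain (Part 4, the free stretch `1 … iA - 1`), which
  the winding lemma of Part 3 forbids.
* Strands from distinct starts end at distinct terminals (Part 1), which leaves `e_v'' → e_A` and
  `e_B → e_v'`.

All [folklore]; no new objects.
-/

namespace Summit.CriticalPhenomena.CardyFormulaZ2.Cruxes.RectilinearCardy.ExcursionKernelCovariance

open Finset Literature.Probability.LatticeModels Literature.Probability.LatticeModels.CollarLegModel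
open Summit.CriticalPhenomena.CardyFormulaZ2.Cruxes.BoundaryDefectGaussianR.RainbowMonomialsInExcursionKernels
open Literature.Probability.Percolation (openGraph openGraph_adj)

section HullToRainbow

variable {ι : LegInsertionData} {V : Finset (ℤ × ℤ)} {d₀ : Dart} {iA iB iC : ℕ}
  (hadm : ι.IsAdmissible V)
  (hflat : ∀ x ∈ insert ι.sink ι.source, ∃ dvec : ℤ × ℤ,
      (dvec = (1, 0) ∨ dvec = (-1, 0) ∨ dvec = (0, 1) ∨ dvec = (0, -1)) ∧
      ∀ v : ℤ × ℤ, (v.1 - x.1) ^ 2 + (v.2 - x.2) ^ 2 ≤ ((ι.sinkLegs : ℤ) + 3) ^ 2 →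
        (v ∈ V ↔ 0 ≤ (v.1 - x.1) * dvec.1 + (v.2 - x.2) * dvec.2))
  (hchart : ∀ u ∈ V, ∀ k : Fin 4, u + dir k ∉ V → ∃ (K : Fin 4) (c₁ c₂ : ℤ),
      (∀ v : ℤ × ℤ, |v.1 - u.1| ≤ 3 → |v.2 - u.2| ≤ 3 →
        (v ∈ V ↔ c₂ ≤ v.1 * (dir (K + 1)).1 + v.2 * (dir (K + 1)).2)) ∨
      (∀ v : ℤ × ℤ, |v.1 - u.1| ≤ 3 → |v.2 - u.2| ≤ 3 →
        (v ∈ V ↔ c₁ ≤ v.1 * (dir K).1 + v.2 * (dir K).2 ∧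
          c₂ ≤ v.1 * (dir (K + 1)).1 + v.2 * (dir (K + 1)).2)) ∨
      (∀ v : ℤ × ℤ, |v.1 - u.1| ≤ 3 → |v.2 - u.2| ≤ 3 →
        (v ∈ V ↔ c₂ ≤ v.1 * (dir (K + 1)).1 + v.2 * (dir (K + 1)).2 ∨
          v.1 * (dir K).1 + v.2 * (dir K).2 ≤ c₁)))
  (hv₀ : d₀.1 ∈ V) (ht₀ : dartTip d₀ ∉ V) (hout : outDart V d₀.1 = some d₀)
  (h2 : 2 ≤ iA) (hAB : iA < iB) (hBC : iB < iC) (hCP : iC < period V d₀)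
  (hcA : ((neighbours ((dsucc V)^[iA] d₀).1).filter (fun y ↦ y ∉ V)).card = 1)
  (hcB : ((neighbours ((dsucc V)^[iB] d₀).1).filter (fun y ↦ y ∉ V)).card = 1)
  (hcC : ((neighbours ((dsucc V)^[iC] d₀).1).filter (fun y ↦ y ∉ V)).card = 1)
  (hsrc : ι.source = {((dsucc V)^[iA] d₀).1, ((dsucc V)^[iB] d₀).1, ((dsucc V)^[iC] d₀).1})
  (hlegs : ∀ x ∈ ι.source, ι.legs x = 1) (hsink : ι.sink = d₀.1) (hsl : ι.sinkLegs = 3)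

include hadm hflat hchart hv₀ ht₀ hout h2 hAB hBC hCP hcA hcB hcC hsrc hlegs hsink hsl in
/-- **The strand from the jump start does not close up on the jump finish** when the jump vertex
is `ω`-joined to the level `-1` block (winding exclusion W1). [cite: arXiv201211672v2, §1.2] -/
theorem ei_not_joined_jump {ω : Finset ((ℤ × ℤ) × Bool)} (hω : ω ⊆ (ι.model V).E)
    (H1 : ∃ x, (∃ s, iA ≤ s ∧ s ≤ iB ∧ ((dsucc V)^[s] d₀).1 = x) ∧ Relation.ReflTransGen (fun b c : ℤ × ℤ ↦ ∃ e ∈ ω, (e.1 = b ∧ SixVertex.edgeTip e = c) ∨ (e.1 = c ∧ SixVertex.edgeTip e = b)) ((dsucc V)^[1] d₀).1 x) :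
    ¬(ι.model V).Joined ω (toSite ((dsucc V)^[1] d₀).1, ((dsucc V)^[1] d₀).2) (toSite ((dsucc V)^[1] d₀).1, ((dsucc V)^[1] d₀).2 + 3) := by
  intro hJ
  obtain ⟨hs0, hs1, hs2, hsA, hsA1, -⟩ := ei_states hv₀ ht₀ hout h2 hAB hBC hCP hcA hcB hcC hsrc hlegs hsink hsl
  obtain ⟨h1c, -, -, -, hAc, -⟩ := ei_ends_cut hadm hflat hv₀ ht₀ hout h2 hAB hBC hCP hcA hcB hcC hsrc hlegs hsink hsl
  obtain ⟨-, ⟨-, h1n⟩, -⟩ := ei_start_pred hadm hflat hv₀ ht₀ hout h2 hAB hBC hCP hcA hcB hcC hsrc hlegs hsink hsl hω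
  have hext : ∀ i, ((dsucc V)^[i] d₀).1 ∈ V ∧ dartTip ((dsucc V)^[i] d₀) ∉ V :=
    fun i => (s3_dsucc_iterate V i).1 d₀ hv₀ ht₀
  obtain ⟨S, hS⟩ : ∃ S : ℕ → WalkState, ∀ t, S t = if t = 0 then ⟨-3, true, 0, 0⟩
      else if t = 1 then ⟨-2, false, 2, 1⟩ else if t ≤ iA then ⟨0, false, 0, 1⟩
      else if t ≤ iB then ⟨-1, true, 0, -1⟩ else if t ≤ iC then ⟨-2, false, 0, -1⟩
      else ⟨-3, true, 0, -1⟩ := ⟨_, fun t => rfl⟩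
  have hW := ei_walk_state hv₀ ht₀ hout h2 hAB hBC hCP hcA hcB hcC hsrc hlegs hsink hsl hS
  obtain ⟨n, -, hiter, hbefore⟩ := hJ
  -- the corner `r = (A, K_A + 3)` before `e_A` along the open spoke `{A, g_A}`
  have hAarc : ((dsucc V)^[iA] d₀).1 ∈ (ι.model V).arcVerts :=
    ei_arc_of_wired hout hsink (by omega) (hext iA).1 (Or.inr (by rw [hsA1]))
  obtain ⟨eS, hceS, hendS⟩ := se_corner_edge ((dsucc V)^[iA] d₀).1 (((dsucc V)^[iA] d₀).2 + 3)
  have hK : ((dsucc V)^[iA] d₀).2 + 3 + 1 = ((dsucc V)^[iA] d₀).2 := (tp_fin4 _).2.2.1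
  rw [hK] at hendS
  have hopen := (tc_spoke_open (ι.model V) hAarc (hext iA).2 hendS).2
  have hσr : nextCorner ((ι.model V).cfgOf ω) (toSite ((dsucc V)^[iA] d₀).1, ((dsucc V)^[iA] d₀).2 + 3) = (toSite (dartTip ((dsucc V)^[iA] d₀)), ((dsucc V)^[iA] d₀).2 + 2) := by
    rw [nextCorner_of_mem ((se_cTgt_mem_cfgOf_iff (ι.model V) ω hceS).2 (Or.inr hopen))]
    simp only
    rw [hK, (tp_fin4 _).2.2.2.2.2, dartTip, se_toSite_add_dir]
  -- `r` is not on the orbit of `e_v''` (that orbit is the strand, closed up by `e_v' ↦ e_v''`)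
  have h1A : (toSite ((dsucc V)^[1] d₀).1, ((dsucc V)^[1] d₀).2 + 3) ≠ (toSite (dartTip ((dsucc V)^[iA] d₀)), ((dsucc V)^[iA] d₀).2 + 2) := fun h =>
    (hext iA).2 (toSite_inj.1 (congrArg Prod.fst h) ▸ (hext 1).1)
  have hperiod : Function.IsPeriodicPt (nextCorner ((ι.model V).cfgOf ω)) (n + 1) (toSite ((dsucc V)^[1] d₀).1, ((dsucc V)^[1] d₀).2) := by
    show (nextCorner ((ι.model V).cfgOf ω))^[n + 1] (toSite ((dsucc V)^[1] d₀).1, ((dsucc V)^[1] d₀).2) = (toSite ((dsucc V)^[1] d₀).1, ((dsucc V)^[1] d₀).2)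
    rw [Function.iterate_succ_apply', hiter, h1n]
  have hrL : ¬∃ m, (nextCorner ((ι.model V).cfgOf ω))^[m] (toSite ((dsucc V)^[1] d₀).1, ((dsucc V)^[1] d₀).2) =
      (toSite ((dsucc V)^[iA] d₀).1, ((dsucc V)^[iA] d₀).2 + 3) := by
    rintro ⟨m, hm⟩
    have hm1 : (nextCorner ((ι.model V).cfgOf ω))^[m + 1] (toSite ((dsucc V)^[1] d₀).1, ((dsucc V)^[1] d₀).2) = (toSite (dartTip ((dsucc V)^[iA] d₀)), ((dsucc V)^[iA] d₀).2 + 2) := by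
      rw [Function.iterate_succ_apply', hm, hσr]
    have hmod := hperiod.iterate_mod_apply (m + 1)
    rw [hm1] at hmod
    have hlt : (m + 1) % (n + 1) < n + 1 := Nat.mod_lt _ (Nat.succ_pos n)
    rcases Nat.lt_or_ge ((m + 1) % (n + 1)) n with h | h
    · exact hbefore _ h (hmod ▸ hAc)
    · have heq : (m + 1) % (n + 1) = n := by omega
      rw [heq, hiter] at hmod
      exact h1A hmod
  -- the jump vertex is `β`-joined to `A`
  have hv : (openGraph ((ι.model V).cfgOf ω) ⊓ zdGraph 2).Reachable (toSite ((dsucc V)^[1] d₀).1, ((dsucc V)^[1] d₀).2).1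
      (toSite ((dsucc V)^[iA] d₀).1, ((dsucc V)^[iA] d₀).2 + 3).1 := by
    obtain ⟨x, ⟨s, hs, hs', rfl⟩, hJ1⟩ := H1
    exact (ei_reach_of_joinedIn (ι.model V) hJ1).trans (ei_reach_chain1 hv₀ ht₀ hout h2 hAB hBC hCP hcA hcB hcC hsrc hlegs hsink hsl ω hs hs').symm
  have hp : (toSite ((dsucc V)^[1] d₀).1, ((dsucc V)^[1] d₀).2) ∈ Function.periodicPts (nextCorner ((ι.model V).cfgOf ω)) := ei_mem_periodicPts hω _
  apply ei_not_faceChain_of_not_mem_orbit hp ⟨0, rfl⟩ ⟨0, rfl⟩ hv hrL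
  -- the closed-edge face chain along the free stretch `1 … iA - 1`
  have hfree : ∀ i, 1 < i → i ≤ iA - 1 → ((dsucc (ι.model V).V)^[i] d₀).1 ∉ (ι.model V).arcVerts := by
    intro i hi hi'
    refine ei_free_not_arc hadm hflat hchart hv₀ ht₀ hout hsink (by omega) ?_ ?_
    · rw [hW i (by omega), hS, if_neg (by omega), if_neg (by omega), if_pos (by omega)]
    · rw [hW (i + 1) (by omega), hS, if_neg (by omega), if_neg (by omega), if_pos (by omega)]
  have hchain := ei_faceChain_of_free (M := (ι.model V)) hω hv₀ ht₀ (a := 1) (b := iA - 1) (by omega) hfree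
  have hMV : (ι.model V).V = V := rfl
  rw [hMV] at hchain
  -- its last face is the face of `r`
  have hds : dsucc V ((dsucc V)^[iA - 1] d₀) = (((dsucc V)^[iA] d₀).1, ((dsucc V)^[iA] d₀).2) := by
    have := Function.iterate_succ_apply' (dsucc V) (iA - 1) d₀
    rw [Nat.succ_eq_add_one, show iA - 1 + 1 = iA by omega] at this
    rw [← this]
  have hface : faceAt (toSite ((dsucc V)^[iA - 1] d₀).1) ((dsucc V)^[iA - 1] d₀).2 =
      faceAt (toSite ((dsucc V)^[iA] d₀).1) (((dsucc V)^[iA] d₀).2 + 3) := by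
    apply ei_ofSite_injective
    have e1 : gapFace ((dsucc V)^[iA - 1] d₀) =
        ofSite (faceAt (toSite ((dsucc V)^[iA - 1] d₀).1) ((dsucc V)^[iA - 1] d₀).2) := ei_gapFace_site _ _
    have e2 : gapFace ((dsucc V)^[iA - 1] d₀) =
        ofSite (faceAt (toSite ((dsucc V)^[iA] d₀).1) (((dsucc V)^[iA] d₀).2 + 3)) := ei_gapFace_dsucc_site hds
    rw [← e1, ← e2]
  rw [hface] at hchain
  exact hchain

include hadm hflat hchart hv₀ ht₀ hout h2 hAB hBC hCP hcA hcB hcC hsrc hlegs hsink hsl in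
/-- **The hull event forces the rainbow pairing (⇐ of the event identity).** If the jump vertex
`v` is `ω`-joined to the level `-1` block `W₁` and no vertex of the level `-3` block `W₂` is
`ω`-joined to `W₁`, then the strands pair `e_v'' → e_A`, `e_B → e_v'`, `e_X → e_C`.
[cite: BaxterKellandWu1976, §3–§4] -/
theorem ei_pairing_of_hull {ω : Finset ((ℤ × ℤ) × Bool)} (hω : ω ⊆ (ι.model V).E)
    (H1 : ∃ x, (∃ s, iA ≤ s ∧ s ≤ iB ∧ ((dsucc V)^[s] d₀).1 = x) ∧ Relation.ReflTransGen (fun b c : ℤ × ℤ ↦ ∃ e ∈ ω, (e.1 = b ∧ SixVertex.edgeTip e = c) ∨ (e.1 = c ∧ SixVertex.edgeTip e = b)) ((dsucc V)^[1] d₀).1 x)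
    (H2 : ¬∃ y, (y = d₀.1 ∨ ∃ s, iC ≤ s ∧ s < period V d₀ ∧ ((dsucc V)^[s] d₀).1 = y) ∧ ∃ x, (∃ s, iA ≤ s ∧ s ≤ iB ∧ ((dsucc V)^[s] d₀).1 = x) ∧ Relation.ReflTransGen (fun b c : ℤ × ℤ ↦ ∃ e ∈ ω, (e.1 = b ∧ SixVertex.edgeTip e = c) ∨ (e.1 = c ∧ SixVertex.edgeTip e = b)) y x) :
    (ι.model V).Joined ω (toSite ((dsucc V)^[1] d₀).1, ((dsucc V)^[1] d₀).2) (toSite (dartTip ((dsucc V)^[iA] d₀)), ((dsucc V)^[iA] d₀).2 + 2) ∧ (ι.model V).Joined ω (toSite (dartTip ((dsucc V)^[iB] d₀)), ((dsucc V)^[iB] d₀).2 + 1) (toSite ((dsucc V)^[1] d₀).1, ((dsucc V)^[1] d₀).2 + 3) ∧ (ι.model V).Joined ω (toSite (dartTip d₀), d₀.2 + 1) (toSite (dartTip ((dsucc V)^[iC] d₀)), ((dsucc V)^[iC] d₀).2 + 2) := by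
  obtain ⟨htrX, -, htr2, -, htrB, -⟩ := ei_ends_tracked hadm hflat hv₀ ht₀ hout h2 hAB hBC hCP hcA hcB hcC hsrc hlegs hsink hsl
  obtain ⟨h1c, -, -, -, -, -, -⟩ := ei_ends_cut hadm hflat hv₀ ht₀ hout h2 hAB hBC hCP hcA hcB hcC hsrc hlegs hsink hsl
  obtain ⟨hgA, -, hgX, -⟩ := ei_ghost_levels hadm hflat hchart hv₀ ht₀ hout h2 hAB hBC hCP hcA hcB hcC hsrc hlegs hsink hsl
  obtain ⟨⟨q, hq, hqX⟩, ⟨-, h1n⟩, ⟨qB, hqB, hqBB⟩⟩ := ei_start_pred hadm hflat hv₀ ht₀ hout h2 hAB hBC hCP hcA hcB hcC hsrc hlegs hsink hsl hω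
  have hext : ∀ i, ((dsucc V)^[i] d₀).1 ∈ V ∧ dartTip ((dsucc V)^[i] d₀) ∉ V :=
    fun i => (s3_dsucc_iterate V i).1 d₀ hv₀ ht₀
  -- the class lemma at level `-3`
  have hPQ : ∀ a ∈ (ι.model V).arcVerts, ((ι.collar V).vertH a = -3 ∧ (fun y => (y = d₀.1 ∨ ∃ s, iC ≤ s ∧ s < period V d₀ ∧ ((dsucc V)^[s] d₀).1 = y)) a) ∨
      ((ι.collar V).vertH a ≠ -3 ∧ (fun x => (∃ s, iA ≤ s ∧ s ≤ iB ∧ ((dsucc V)^[s] d₀).1 = x)) a) := by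
    intro a ha
    rcases ei_arc_level hadm hflat hchart hv₀ ht₀ hout h2 hAB hBC hCP hcA hcB hcC hsrc hlegs hsink hsl ha with ⟨h, hw⟩ | ⟨h, hw⟩
    · exact Or.inr ⟨by rw [h]; decide, hw⟩
    · exact Or.inl ⟨h, hw⟩
  have hsep : ∀ w a, (fun y => (y = d₀.1 ∨ ∃ s, iC ≤ s ∧ s < period V d₀ ∧ ((dsucc V)^[s] d₀).1 = y)) w → (fun x => (∃ s, iA ≤ s ∧ s ≤ iB ∧ ((dsucc V)^[s] d₀).1 = x)) a → ¬Relation.ReflTransGen (fun b c : ℤ × ℤ ↦ ∃ e ∈ ω, (e.1 = b ∧ SixVertex.edgeTip e = c) ∨ (e.1 = c ∧ SixVertex.edgeTip e = b)) w a :=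
    fun w a hw ha hJ => H2 ⟨w, hw, a, ha, hJ⟩
  obtain ⟨x₁, hx₁, hJ1⟩ := H1
  -- (a) the strand from `e_X` ends at `e_C`
  have hJX : (ι.model V).Joined ω (toSite (dartTip d₀), d₀.2 + 1) (toSite (dartTip ((dsucc V)^[iC] d₀)), ((dsucc V)^[iC] d₀).2 + 2) := by
    obtain ⟨T, hT, hJ⟩ := ei_pairing hadm hflat hchart hv₀ ht₀ hout h2 hAB hBC hCP hcA hcB hcC hsrc hlegs hsink hsl hω (s := (toSite (dartTip d₀), d₀.2 + 1)) (Or.inl rfl)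
    have hcl := ei_class_reachable hadm hflat hchart hω (-3) _ _ hPQ hsep (ei_reachable_of_joined hJ)
      (Or.inr ⟨by simpa using ht₀, by simpa using hgX⟩)
    rcases hT with rfl | rfl | rfl
    · simp only [ofSite_toSite] at hcl
      rcases hcl with ⟨-, w, hw, hJw⟩ | ⟨hv, -⟩
      · exact absurd (hJw.trans hJ1) (hsep w x₁ hw hx₁)
      · exact absurd (hext 1).1 hv
    · simp only [ofSite_toSite] at hcl
      rcases hcl with ⟨hV, -⟩ | ⟨-, hl⟩
      · exact absurd hV (hext iA).2
      · rw [hgA] at hl; exact absurd hl (by decide)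
    · exact hJ
  -- distinct starts
  have h2X : (toSite ((dsucc V)^[1] d₀).1, ((dsucc V)^[1] d₀).2) ≠ (toSite (dartTip d₀), d₀.2 + 1) := fun h => ht₀ (toSite_inj.1 (congrArg Prod.fst h) ▸ (hext 1).1)
  have hB2 : (toSite (dartTip ((dsucc V)^[iB] d₀)), ((dsucc V)^[iB] d₀).2 + 1) ≠ (toSite ((dsucc V)^[1] d₀).1, ((dsucc V)^[1] d₀).2) := fun h => (hext iB).2 (toSite_inj.1 (congrArg Prod.fst h) ▸ (hext 1).1)
  have hBX : (toSite (dartTip ((dsucc V)^[iB] d₀)), ((dsucc V)^[iB] d₀).2 + 1) ≠ (toSite (dartTip d₀), d₀.2 + 1) := by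
    intro h
    obtain ⟨h1, h2⟩ := Prod.ext_iff.1 h
    simp only [toSite_inj] at h1 h2
    have hK : ((dsucc V)^[iB] d₀).2 = d₀.2 := add_right_cancel h2
    rw [dartTip, dartTip, hK] at h1
    have hv : ((dsucc V)^[iB] d₀).1 = d₀.1 := add_right_cancel h1
    have hd : (dsucc V)^[iB] d₀ = (dsucc V)^[0] d₀ := Prod.ext hv hK
    have := sm_iter_inj hv₀ ht₀ (by omega) (by omega) hd
    omega
  -- (b)+(c) the other two strands
  have hn21 := ei_not_joined_jump hadm hflat hchart hv₀ ht₀ hout h2 hAB hBC hCP hcA hcB hcC hsrc hlegs hsink hsl hω ⟨x₁, hx₁, hJ1⟩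
  obtain ⟨T, hT, hJ2⟩ := ei_pairing hadm hflat hchart hv₀ ht₀ hout h2 hAB hBC hCP hcA hcB hcC hsrc hlegs hsink hsl hω (s := (toSite ((dsucc V)^[1] d₀).1, ((dsucc V)^[1] d₀).2)) (Or.inr (Or.inl rfl))
  have hJA : (ι.model V).Joined ω (toSite ((dsucc V)^[1] d₀).1, ((dsucc V)^[1] d₀).2) (toSite (dartTip ((dsucc V)^[iA] d₀)), ((dsucc V)^[iA] d₀).2 + 2) := by
    rcases hT with rfl | rfl | rfl
    · exact absurd hJ2 hn21
    · exact hJ2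
    · exact absurd (ei_start_eq_of_joined hω htr2 htrX h1n (Or.inl h1c) hqX (Or.inl hq) hJ2 hJX) h2X
  obtain ⟨T', hT', hJB⟩ := ei_pairing hadm hflat hchart hv₀ ht₀ hout h2 hAB hBC hCP hcA hcB hcC hsrc hlegs hsink hsl hω (s := (toSite (dartTip ((dsucc V)^[iB] d₀)), ((dsucc V)^[iB] d₀).2 + 1)) (Or.inr (Or.inr rfl))
  have hJB' : (ι.model V).Joined ω (toSite (dartTip ((dsucc V)^[iB] d₀)), ((dsucc V)^[iB] d₀).2 + 1) (toSite ((dsucc V)^[1] d₀).1, ((dsucc V)^[1] d₀).2 + 3) := by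
    rcases hT' with rfl | rfl | rfl
    · exact hJB
    · exact absurd (ei_start_eq_of_joined hω htrB htr2 hqBB (Or.inl hqB) h1n (Or.inl h1c) hJB hJA) hB2
    · exact absurd (ei_start_eq_of_joined hω htrB htrX hqBB (Or.inl hqB) hqX (Or.inl hq) hJB hJX) hBX
  exact ⟨hJA, hJB', hJX⟩

end HullToRainbow

/-- **Registered form of `ei_pairing_of_hull`** (landing anchor, all hypotheses explicit).
[cite: BaxterKellandWu1976, §3–§4] -/
theorem ei_pairing_of_hull_explicit {ι : LegInsertionData} {V : Finset (ℤ × ℤ)} {d₀ : Dart} {iA iB iC : ℕ}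
    (hadm : ι.IsAdmissible V)
    (hflat : ∀ x ∈ insert ι.sink ι.source, ∃ dvec : ℤ × ℤ,
      (dvec = (1, 0) ∨ dvec = (-1, 0) ∨ dvec = (0, 1) ∨ dvec = (0, -1)) ∧
      ∀ v : ℤ × ℤ, (v.1 - x.1) ^ 2 + (v.2 - x.2) ^ 2 ≤ ((ι.sinkLegs : ℤ) + 3) ^ 2 →
        (v ∈ V ↔ 0 ≤ (v.1 - x.1) * dvec.1 + (v.2 - x.2) * dvec.2))
    (hchart : ∀ u ∈ V, ∀ k : Fin 4, u + dir k ∉ V → ∃ (K : Fin 4) (c₁ c₂ : ℤ),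
      (∀ v : ℤ × ℤ, |v.1 - u.1| ≤ 3 → |v.2 - u.2| ≤ 3 →
        (v ∈ V ↔ c₂ ≤ v.1 * (dir (K + 1)).1 + v.2 * (dir (K + 1)).2)) ∨
      (∀ v : ℤ × ℤ, |v.1 - u.1| ≤ 3 → |v.2 - u.2| ≤ 3 →
        (v ∈ V ↔ c₁ ≤ v.1 * (dir K).1 + v.2 * (dir K).2 ∧
          c₂ ≤ v.1 * (dir (K + 1)).1 + v.2 * (dir (K + 1)).2)) ∨
      (∀ v : ℤ × ℤ, |v.1 - u.1| ≤ 3 → |v.2 - u.2| ≤ 3 →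
        (v ∈ V ↔ c₂ ≤ v.1 * (dir (K + 1)).1 + v.2 * (dir (K + 1)).2 ∨
          v.1 * (dir K).1 + v.2 * (dir K).2 ≤ c₁)))
    (hv₀ : d₀.1 ∈ V) (ht₀ : dartTip d₀ ∉ V) (hout : outDart V d₀.1 = some d₀)
  (h2 : 2 ≤ iA) (hAB : iA < iB) (hBC : iB < iC) (hCP : iC < period V d₀)
  (hcA : ((neighbours ((dsucc V)^[iA] d₀).1).filter (fun y ↦ y ∉ V)).card = 1)
  (hcB : ((neighbours ((dsucc V)^[iB] d₀).1).filter (fun y ↦ y ∉ V)).card = 1)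
  (hcC : ((neighbours ((dsucc V)^[iC] d₀).1).filter (fun y ↦ y ∉ V)).card = 1)
  (hsrc : ι.source = {((dsucc V)^[iA] d₀).1, ((dsucc V)^[iB] d₀).1, ((dsucc V)^[iC] d₀).1})
  (hlegs : ∀ x ∈ ι.source, ι.legs x = 1) (hsink : ι.sink = d₀.1) (hsl : ι.sinkLegs = 3) {ω : Finset ((ℤ × ℤ) × Bool)} (hω : ω ⊆ (ι.model V).E)
    (H1 : ∃ x, (∃ s, iA ≤ s ∧ s ≤ iB ∧ ((dsucc V)^[s] d₀).1 = x) ∧ Relation.ReflTransGen (fun b c : ℤ × ℤ ↦ ∃ e ∈ ω, (e.1 = b ∧ SixVertex.edgeTip e = c) ∨ (e.1 = c ∧ SixVertex.edgeTip e = b)) ((dsucc V)^[1] d₀).1 x)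
    (H2 : ¬∃ y, (y = d₀.1 ∨ ∃ s, iC ≤ s ∧ s < period V d₀ ∧ ((dsucc V)^[s] d₀).1 = y) ∧ ∃ x, (∃ s, iA ≤ s ∧ s ≤ iB ∧ ((dsucc V)^[s] d₀).1 = x) ∧ Relation.ReflTransGen (fun b c : ℤ × ℤ ↦ ∃ e ∈ ω, (e.1 = b ∧ SixVertex.edgeTip e = c) ∨ (e.1 = c ∧ SixVertex.edgeTip e = b)) y x) :
    (ι.model V).Joined ω (toSite ((dsucc V)^[1] d₀).1, ((dsucc V)^[1] d₀).2) (toSite (dartTip ((dsucc V)^[iA] d₀)), ((dsucc V)^[iA] d₀).2 + 2) ∧ (ι.model V).Joined ω (toSite (dartTip ((dsucc V)^[iB] d₀)), ((dsucc V)^[iB] d₀).2 + 1) (toSite ((dsucc V)^[1] d₀).1, ((dsucc V)^[1] d₀).2 + 3) ∧ (ι.model V).Joined ω (toSite (dartTip d₀), d₀.2 + 1) (toSite (dartTip ((dsucc V)^[iC] d₀)), ((dsucc V)^[iC] d₀).2 + 2) :=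
  ei_pairing_of_hull hadm hflat hchart hv₀ ht₀ hout h2 hAB hBC hCP hcA hcB hcC hsrc hlegs hsink hsl hω H1 H2

end Summit.CriticalPhenomena.CardyFormulaZ2.Cruxes.RectilinearCardy.ExcursionKernelCovariance
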